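import Literature.Probability.Percolation.GMSchemeStep
import HarnessLib

/-!
# The Grimmett–Marstrand exploration on `ℤ^d`: the consistency conditions hold along every run

Topic: `Literature/Probability/Percolation`. Third file on the concrete scheme `GMStep.GMParams.scheme`
(`GMScheme.lean`, `GMSchemeStep.lean`) of the Martineau–Tassion form of the Grimmett–Marstrand
renormalisation (S. Martineau, V. Tassion, Ann. Probab. 45 (2017), §4), towards the named fact
`Literature.Probability.Percolation.GrimmettMarstrand1990_halfSpace`. Here the field `probes` of `LScheme.Lawful`: along the run
on every configuration `ω` of layered lattice coins, whenever a candidate macro-edge exists the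
consistency conditions `OK` hold, so that the explorer does attempt it. The invariant of the run
(`RunInv`) records: the recorded open coins were examined, are open in `ω`, and the examined coins
are open in `ω` iff recorded open; the examined coins avoid the initial ones and sit, on relevant
layers, on pairs meeting the current cluster; every attempt made is an examined macro-edge whose
source lay in the box of its cell; occupied cells lie within macro-distance "number of attempts"
of the origin and their boxes meet the current cluster. The one geometric point is the freshness of
the sprinkling layer (inside `ok_of_runInv`): a coin of the layer of the new attempt `(a, dir)`
examined earlier would belong to an earlier attempt `(a', dir)` with `a' ≡ a (mod 5)` whose box meets
the new box, forcing `|a - a'| ≤ 4`, hence `a' = a` — but a directed macro-edge is attempted at most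
once (Martineau–Tassion, Lemma 4.1: "the exploration is guaranteed to visit each corridor at most
`κ + 1` times"). Finally `lawful_scheme`: the scheme is `Lawful` with
`ε = η (1-p)^{-t} + (1 - p^{r+1})^t` under the finite-size hypothesis `FC η`.

## References

* S. Martineau, V. Tassion, Ann. Probab. 45 (2017) 1247–1277, arXiv:1312.1946, §4, Lemma 4.1 and
  the algorithm of Lemma 4.4 [MartineauTassion2017].
-/

noncomputable section

namespace Literature.Probability.Percolation

namespace GMStep

namespace GMParams

open MeasureTheory ProbeHistory DCT16 LatticeModels GM LScheme GadgetSystem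
open scoped Classical

variable (P : GMParams)

/-! ## One step of the run -/

section Run

variable (ω : BondConfig (Site P.d × Layer GMParams.L P.r))

/-- The history of the run after `n` steps. [folklore] -/
abbrev hst (n : ℕ) : ProbeHistory (Site P.d × Layer GMParams.L P.r) := (P.scheme).E.hist n ω

/-- The fine state of the run after `n` steps. [folklore] -/
abbrev Rn (n : ℕ) : RState P := P.replay (P.hst ω n)

variable {ω}

/-- The history after one more step when no probe is made. [folklore] -/
theorem hst_succ_of_next_none {n : ℕ} (h : P.next (P.hst ω n) = none) : P.hst ω (n + 1) = none :: P.hst ω n := by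
  show (P.scheme).E.step (P.hst ω n) ω :: P.hst ω n = _
  rw [(P.scheme).E.step_of_none h]

/-- The history after one more step when the probe `Q` is made. [folklore] -/
theorem hst_succ_of_next_some {n : ℕ} {Q : AProbe (Site P.d × Layer GMParams.L P.r)} (h : P.next (P.hst ω n) = some Q) :
    P.hst ω (n + 1) = some (Q.record ω) :: P.hst ω n := by
  show (P.scheme).E.step (P.hst ω n) ω :: P.hst ω n = _
  rw [(P.scheme).E.step_of_some h]

/-! ## The invariant of the run -/

/-- **The invariant of the run** on `ω` after `n` steps (see the module docstring).
[cite: MartineauTassion2017, §4 (the algorithm of Lemma 4.4)] -/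
structure RunInv (ω : BondConfig (Site P.d × Layer GMParams.L P.r)) (n : ℕ) : Prop where
  opens_sub : P.opens (P.hst ω n) ⊆ supp (P.hst ω n)
  opens_open : (↑(P.opens (P.hst ω n)) : Set (Coin P)) ⊆ ω
  consistent : ∀ c ∈ supp (P.hst ω n), c ∈ ω ↔ c ∈ P.opens (P.hst ω n)
  supp_U₀ : Disjoint (supp (P.hst ω n)) P.U₀
  supp_meets : ∀ c ∈ supp (P.hst ω n), ∃ e' : Sym2 (Site P.d), ∃ l ∈ P.RelOf (P.Rn ω n).steps e',
    c ∈ layerCoins (r := P.r) l e' ∧ ∃ v ∈ e', v ∈ P.Hcur (P.Rn ω n) (P.hst ω n)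
  steps_exam : ∀ s ∈ (P.Rn ω n).steps, s.1 ∈ (P.Rn ω n).lst.exam
  steps_src : ∀ s ∈ (P.Rn ω n).steps, s.2 ∈ P.cellBox s.1.1
  occ_le : ∀ a ∈ (P.Rn ω n).lst.occ, |a 0| ≤ (P.Rn ω n).steps.length ∧ |a 1| ≤ (P.Rn ω n).steps.length
  occ_meets : ∀ a ∈ (P.Rn ω n).lst.occ, (P.Hcur (P.Rn ω n) (P.hst ω n) ∩ P.cellBox a).Nonempty

/-- The origin lies in the box of the origin cell. [folklore] -/
theorem zero_mem_cellBox_zero : (0 : Site P.d) ∈ P.cellBox 0 := by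
  rw [mem_cellBox_iff]; intro j; simp [ctr_apply]

/-- The invariant holds initially. [folklore] -/
theorem runInv_zero (ω : BondConfig (Site P.d × Layer GMParams.L P.r)) : P.RunInv ω 0 := by
  have h0 : P.hst ω 0 = [] := rfl
  have hR : P.Rn ω 0 = ⟨[], LState.start⟩ := rfl
  have hop : P.opens (P.hst ω 0) = ∅ := rfl
  have hsu : supp (P.hst ω 0) = ∅ := by rw [h0, supp_nil]
  refine ⟨?_, ?_, ?_, ?_, ?_, ?_, ?_, ?_, ?_⟩
  · rw [hop]; exact Finset.empty_subset _
  · rw [hop, Finset.coe_empty]; exact Set.empty_subset _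
  · rw [hsu]; simp
  · rw [hsu]; exact disjoint_bot_left
  · rw [hsu]; simp
  · rw [hR]; simp
  · rw [hR]; simp
  · rw [hR]; simp [LState.start]
  · rw [hR]
    simp only [LState.start, Finset.mem_singleton, forall_eq]
    exact ⟨0, Finset.mem_inter.2 ⟨P.zero_mem_Hcur _ _, P.zero_mem_cellBox_zero⟩⟩

variable {P}

/-- Under the invariant, the consistency conditions hold for the chosen macro-edge.
[cite: MartineauTassion2017, §4 Lemma 4.1 (each corridor is visited a bounded number of times)] -/
theorem ok_of_runInv {ω : BondConfig (Site P.d × Layer GMParams.L P.r)} (hωE : ω ⊆ (layered (zdGraph P.d) GMParams.L P.r).edgeSet)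
    {n : ℕ} (hI : P.RunInv ω n) {e : Site 2 × MDir} (hc : (P.Rn ω n).lst.choice = some e) : P.OK (P.hst ω n) e := by
  obtain ⟨he1, he2, he3⟩ := LState.cand_of_choice hc
  have hsrc : P.src (P.Rn ω n) (P.hst ω n) e ∈ P.Hcur (P.Rn ω n) (P.hst ω n) ∩ P.cellBox e.1 :=
    P.src_mem (hI.occ_meets e.1 he1)
  refine ⟨hI.opens_sub, hI.opens_open.trans hωE, fun c hc' => ?_, fun e' he' => ?_, hsrc, hI.supp_U₀, hI.occ_le e.1 he1⟩
  · obtain ⟨e'', l, -, hcl, v, hv, hvH⟩ := hI.supp_meets c hc'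
    exact ⟨e'', ⟨l, hcl⟩, v, hv, hvH⟩
  · -- freshness of the sprinkling layer
    rw [Finset.disjoint_left]
    intro c hcl hcs
    obtain ⟨e'', l, hl, hcl'', -, -, -⟩ := hI.supp_meets c hcs
    have hee : e' = e'' := P.eq_of_mem_layerCoins hcl hcl''
    subst hee
    have hll : layerOf e = l := by
      by_contra hne
      exact Finset.disjoint_left.1 (disjoint_layerCoins_of_layer_ne (r := P.r) hne e') hcl hcl''
    subst hll
    rcases (P.mem_RelOf_iff).1 hl with h0 | ⟨s, hs, hZs, hls⟩
    · exact layerOf_ne_zero e h0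
    · -- the earlier attempt `s` has the same direction and a congruent source cell, and its box meets ours
      obtain ⟨hdir, hm0, hm1⟩ := eq_of_layerOf_eq hls
      have hxs : s.2 ∈ P.cellBox s.1.1 := hI.steps_src s hs
      have hx : P.src (P.Rn ω n) (P.hst ω n) e ∈ P.cellBox e.1 := (Finset.mem_inter.1 hsrc).2
      -- a common endpoint of `e'`
      induction e' using Sym2.ind with
      | h u w =>
        have hu1 : u ∈ ball s.2 P.n := (mem_ballEdges.1 hZs).2 u (Sym2.mem_mk_left u w)
        have hu2 : u ∈ ball (P.src (P.Rn ω n) (P.hst ω n) e) P.n := (mem_ballEdges.1 he').2 u (Sym2.mem_mk_left u w)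
        rw [mem_ball] at hu1 hu2
        rw [mem_cellBox_iff] at hxs hx
        have key : ∀ i : Fin 2, s.1.1 i = e.1 i := by
          intro i
          -- compare the in-plane coordinate of the axis of `i`
          set j : Fin P.d := if i = 0 then P.ax0 else P.ax1 with hj
          have h1 := hu1 j; have h2 := hu2 j; have h3 := hxs j; have h4 := hx j
          rw [abs_le] at h3 h4
          have hcj : ∀ a : Site 2, P.ctr a j = P.n * a i := by
            intro a; rw [ctr_apply]
            by_cases hi : i = 0
            · subst hi; rw [hj, if_pos rfl, if_pos rfl]
            · have hi1 : i = 1 := by fin_cases i <;> simp_all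
              subst hi1
              have h10 : ¬((1 : Fin 2) = 0) := by decide
              rw [hj, if_neg h10, if_neg P.ax0_ne_ax1.symm, if_pos rfl]
          rw [hcj] at h3 h4
          have hn : (1 : ℤ) ≤ P.n := by exact_mod_cast P.one_le_n
          -- `n |s.1.1 i - e.1 i| ≤ 4 n`
          have hbound : (P.n : ℤ) * (s.1.1 i - e.1 i) ≤ 4 * P.n ∧ -(4 * (P.n : ℤ)) ≤ P.n * (s.1.1 i - e.1 i) := by
            constructor <;> nlinarith [h1.1, h1.2, h2.1, h2.2, h3.1, h3.2, h4.1, h4.2]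
          have hle : s.1.1 i - e.1 i ≤ 4 := by
            by_contra hgt; push Not at hgt; nlinarith [hbound.1]
          have hge : -4 ≤ s.1.1 i - e.1 i := by
            by_contra hlt; push Not at hlt; nlinarith [hbound.2]
          have hmod : s.1.1 i % 5 = e.1 i % 5 := by fin_cases i <;> [exact hm0; exact hm1]
          omega
        have hse : s.1 = e := Prod.ext (funext key) hdir
        exact he3 (hse ▸ hI.steps_exam s hs)

/-- Along the run the explorer probes exactly when a macro-edge is chosen (under the invariant). [folklore] -/
theorem next_hst_eq {ω : BondConfig (Site P.d × Layer GMParams.L P.r)} (hωE : ω ⊆ (layered (zdGraph P.d) GMParams.L P.r).edgeSet)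
    {n : ℕ} (hI : P.RunInv ω n) {e : Site 2 × MDir} (hc : (P.Rn ω n).lst.choice = some e) :
    P.next (P.hst ω n) = some (P.probeOf (P.hst ω n) e (ok_of_runInv hωE hI hc)) := by
  unfold next
  rw [hc]
  simp only
  rw [dif_pos (ok_of_runInv hωE hI hc)]

/-- `RelOf` is monotone under extension of the list of attempts. [folklore] -/
theorem RelOf_mono_of_subset {steps steps' : List (StepRec P)} (h : ∀ s ∈ steps, s ∈ steps') (e : Sym2 (Site P.d)) :
    P.RelOf steps e ⊆ P.RelOf steps' e := by
  intro l hl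
  rw [mem_RelOf_iff] at hl ⊢
  rcases hl with hl | ⟨s, hs, hZ, hls⟩
  · exact Or.inl hl
  · exact Or.inr ⟨s, h s hs, hZ, hls⟩

/-- **The current cluster after a probe is the probe's patched cluster** (the bridge
`clus_read_eq_pclus` and the consistency of the record). [folklore] -/
theorem Hcur_succ_eq_pclus {ω : BondConfig (Site P.d × Layer GMParams.L P.r)} {n : ℕ} {e : Site 2 × MDir} (hOK : P.OK (P.hst ω n) e)
    (hc : (P.Rn ω n).lst.choice = some e) (hnext : P.next (P.hst ω n) = some (P.probeOf (P.hst ω n) e hOK)) :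
    P.Hcur (P.Rn ω (n + 1)) (P.hst ω (n + 1)) =
      pclus (P.RelOf (P.steps' (P.Rn ω n) (P.hst ω n) e)) (P.Dom ((P.Rn ω n).steps.length + 1)) 0 (P.Rv' (P.hst ω n)) (P.Op' (P.hst ω n)) ω := by
  have hh := P.hst_succ_of_next_some hnext
  have hR : P.Rn ω (n + 1) = ⟨P.steps' (P.Rn ω n) (P.hst ω n) e, (P.Rn ω n).lst.update e
      (P.succVal (P.Rn ω n) (P.hst ω n) e ((P.probeOf (P.hst ω n) e hOK).record ω).2)⟩ := by
    rw [Rn, hh, P.replay_cons_some_of_choice hc]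
  rw [← clus_read_eq_pclus (P.Op'_subset_Rv' hOK) ω, Hcur, hR]
  simp only [steps', List.length_cons]
  congr 1
  rw [hh, known]
  show (↑(((P.probeOf (P.hst ω n) e hOK).record ω).2 ∪ P.opens (P.hst ω n)) : Set (Coin P)) ∪ ↑P.U₀ = _
  rw [Op', Finset.coe_union, Finset.coe_union]
  ext c
  simp only [Set.mem_union, Finset.mem_coe]
  constructor
  · rintro ((h | h) | h)
    · exact Or.inr h
    · exact Or.inl (Or.inl h)
    · exact Or.inl (Or.inr h)
  · rintro ((h | h) | h)
    · exact Or.inl (Or.inr h)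
    · exact Or.inr h
    · exact Or.inl (Or.inl h)

/-- The current cluster grows along the run. [folklore] -/
theorem Hcur_mono_succ {ω : BondConfig (Site P.d × Layer GMParams.L P.r)} (hωE : ω ⊆ (layered (zdGraph P.d) GMParams.L P.r).edgeSet)
    {n : ℕ} (hI : P.RunInv ω n) : P.Hcur (P.Rn ω n) (P.hst ω n) ⊆ P.Hcur (P.Rn ω (n + 1)) (P.hst ω (n + 1)) := by
  rcases Option.eq_none_or_eq_some ((P.Rn ω n).lst.choice) with hc | ⟨e, hc⟩
  · have hnext : P.next (P.hst ω n) = none := by unfold next; rw [hc]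
    have hh := P.hst_succ_of_next_none hnext
    have : P.Rn ω (n + 1) = P.Rn ω n := by rw [Rn, hh]; rfl
    rw [this, hh]
    exact subset_of_eq rfl
  · have hnext := next_hst_eq hωE hI hc
    have hh := P.hst_succ_of_next_some hnext
    have hR : P.Rn ω (n + 1) = ⟨P.steps' (P.Rn ω n) (P.hst ω n) e, (P.Rn ω n).lst.update e
        (P.succVal (P.Rn ω n) (P.hst ω n) e ((P.probeOf (P.hst ω n) e (ok_of_runInv hωE hI hc)).record ω).2)⟩ := by
      rw [Rn, hh, P.replay_cons_some_of_choice hc]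
    rw [Hcur, Hcur, hR, hh]
    simp only [steps', List.length_cons]
    refine clus_mono (fun e' => P.RelOf_mono_cons _ _ e') ?_ (P.Dom_mono (Nat.le_succ _)) 0
    rw [known, known]
    exact Set.union_subset_union_left _ (Finset.coe_subset.2 (P.opens_subset_cons _ _))

/-- The coordinates of the target cell differ from those of the source cell by at most one. [folklore] -/
theorem abs_tgt_apply_le (e : Site 2 × MDir) (i : Fin 2) : |tgt e i| ≤ |e.1 i| + 1 := by
  rw [tgt, Pi.add_apply]
  have hst : |stepVec e.2 i| ≤ 1 := by
    obtain ⟨a, j, b⟩ := e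
    by_cases hij : i = j
    · subst hij; rw [stepVec_apply_self]; cases b <;> simp
    · rw [stepVec_apply_of_ne b hij]; simp
  have := abs_add_le (e.1 i) (stepVec e.2 i)
  linarith

/-- **The invariant is preserved** by one step of the run on a configuration of layered lattice coins.
[cite: MartineauTassion2017, §4 (the algorithm of Lemma 4.4)] -/
theorem runInv_succ {ω : BondConfig (Site P.d × Layer GMParams.L P.r)} (hωE : ω ⊆ (layered (zdGraph P.d) GMParams.L P.r).edgeSet)
    {n : ℕ} (hI : P.RunInv ω n) : P.RunInv ω (n + 1) := by
  have hHmono := Hcur_mono_succ hωE hI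
  rcases Option.eq_none_or_eq_some ((P.Rn ω n).lst.choice) with hc | ⟨e, hc⟩
  · -- nothing chosen: nothing changes
    have hnext : P.next (P.hst ω n) = none := by unfold next; rw [hc]
    have hh := P.hst_succ_of_next_none hnext
    have hR : P.Rn ω (n + 1) = P.Rn ω n := by rw [Rn, hh]; rfl
    have hop : P.opens (P.hst ω (n + 1)) = P.opens (P.hst ω n) := by rw [hh]; rfl
    have hsu : supp (P.hst ω (n + 1)) = supp (P.hst ω n) := by rw [hh, supp_cons_none]
    have hHc : P.Hcur (P.Rn ω (n + 1)) (P.hst ω (n + 1)) = P.Hcur (P.Rn ω n) (P.hst ω n) := by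
      rw [Hcur, Hcur, hR, known, known, hop]
    exact ⟨by rw [hop, hsu]; exact hI.opens_sub, by rw [hop]; exact hI.opens_open, by rw [hsu, hop]; exact hI.consistent,
      by rw [hsu]; exact hI.supp_U₀, by rw [hHc, hsu, hR]; exact hI.supp_meets, by rw [hR]; exact hI.steps_exam,
      by rw [hR]; exact hI.steps_src, by rw [hR]; exact hI.occ_le, by rw [hHc, hR]; exact hI.occ_meets⟩
  · -- an attempt along `e`
    have hOK := ok_of_runInv hωE hI hc
    have hnext := next_hst_eq hωE hI hc
    set Q := P.probeOf (P.hst ω n) e hOK with hQ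
    have hh := P.hst_succ_of_next_some hnext
    have hR : P.Rn ω (n + 1) = ⟨P.steps' (P.Rn ω n) (P.hst ω n) e, (P.Rn ω n).lst.update e
        (P.succVal (P.Rn ω n) (P.hst ω n) e (Q.record ω).2)⟩ := by
      rw [Rn, hh, P.replay_cons_some_of_choice hc]
    have hKeq := Hcur_succ_eq_pclus hOK hc hnext
    -- the record
    have hrev : (Q.record ω).1 = revealOf (P.RelOf (P.steps' (P.Rn ω n) (P.hst ω n) e)) (P.Dom ((P.Rn ω n).steps.length + 1)) 0
        (P.Rv' (P.hst ω n)) (P.Op' (P.hst ω n)) ω := rfl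
    have hobs : (Q.record ω).2 = obs ω (Q.record ω).1 := rfl
    have hopens : P.opens (P.hst ω (n + 1)) = (Q.record ω).2 ∪ P.opens (P.hst ω n) := by rw [hh]; rfl
    have hsupp : supp (P.hst ω (n + 1)) = (Q.record ω).1 ∪ supp (P.hst ω n) := by
      rw [hh, supp_cons_some]; ext c; simp only [Finset.mem_union]
    have hsteps : (P.Rn ω (n + 1)).steps = P.steps' (P.Rn ω n) (P.hst ω n) e := by rw [hR]
    have hdisj : Disjoint (Q.record ω).1 (P.Rv' (P.hst ω n)) := by rw [hrev]; exact disjoint_revealOf ω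
    have hdU : Disjoint (Q.record ω).1 P.U₀ := Finset.disjoint_left.2 fun c hc hcU =>
      Finset.disjoint_left.1 hdisj hc (by simp only [Rv', Finset.mem_union]; exact Or.inr hcU)
    have hdS : Disjoint (Q.record ω).1 (supp (P.hst ω n)) := Finset.disjoint_left.2 fun c hc hcs =>
      Finset.disjoint_left.1 hdisj hc (by simp only [Rv', Finset.mem_union]; exact Or.inl hcs)
    obtain ⟨he1, he2, he3⟩ := LState.cand_of_choice hc
    refine ⟨?_, ?_, ?_, ?_, ?_, ?_, ?_, ?_, ?_⟩
    · -- opens_sub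
      rw [hopens, hsupp, hobs]
      exact Finset.union_subset_union (obs_subset _ _) hI.opens_sub
    · -- opens_open
      rw [hopens, hobs, Finset.coe_union]
      exact Set.union_subset (fun c hc' => (mem_obs_iff.1 (Finset.mem_coe.1 hc')).2) hI.opens_open
    · -- consistent
      intro c hc'
      rw [hopens, hobs, Finset.mem_union, mem_obs_iff]
      rw [hsupp, Finset.mem_union] at hc'
      rcases hc' with hc' | hc'
      · have hcs : c ∉ supp (P.hst ω n) := fun h => Finset.disjoint_left.1 hdS hc' h
        constructor
        · intro h; exact Or.inl ⟨hc', h⟩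
        · rintro (⟨-, h⟩ | h)
          · exact h
          · exact absurd (hI.opens_sub h) hcs
      · rw [hI.consistent c hc']
        constructor
        · intro h; exact Or.inr h
        · rintro (⟨hc1, -⟩ | h)
          · exact absurd hc' (fun h' => Finset.disjoint_left.1 hdS hc1 h')
          · exact h
    · -- supp_U₀
      rw [hsupp, Finset.disjoint_union_left]
      exact ⟨hdU, hI.supp_U₀⟩
    · -- supp_meets
      intro c hc'
      rw [hsupp, Finset.mem_union] at hc'
      rw [hsteps]
      rcases hc' with hc' | hc'
      · rw [hrev, mem_revealOf_iff] at hc'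
        obtain ⟨⟨e', he', l, hl, hcl⟩, -⟩ := hc'
        refine ⟨e', l, hl, hcl, ?_⟩
        simp only [meetPairs, Finset.mem_filter] at he'
        obtain ⟨-, -, v, hv, hvK⟩ := he'
        refine ⟨v, hv, ?_⟩
        rw [hKeq]
        exact hvK
      · obtain ⟨e', l, hl, hcl, v, hv, hvH⟩ := hI.supp_meets c hc'
        exact ⟨e', l, P.RelOf_mono_cons _ _ e' hl, hcl, v, hv, hHmono hvH⟩
    · -- steps_exam
      intro s hs
      rw [hR] at hs ⊢
      simp only [steps', List.mem_cons, LState.exam_update, Finset.mem_insert] at hs ⊢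
      rcases hs with rfl | hs
      · exact Or.inl rfl
      · exact Or.inr (hI.steps_exam s hs)
    · -- steps_src
      intro s hs
      rw [hR] at hs
      simp only [steps', List.mem_cons] at hs
      rcases hs with rfl | hs
      · exact (Finset.mem_inter.1 hOK.src_mem).2
      · exact hI.steps_src s hs
    · -- occ_le
      intro a ha
      rw [hR] at ha ⊢
      simp only [steps', List.length_cons, Nat.cast_add, Nat.cast_one]
      have hlen := hI.occ_le
      rcases Finset.mem_insert.1 (LState.occ_update_subset _ _ _ ha) with rfl | ha'
      · have h0 := abs_tgt_apply_le e 0; have h1 := abs_tgt_apply_le e 1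
        have := hlen e.1 he1
        constructor <;> linarith [this.1, this.2]
      · have := hlen a ha'; constructor <;> linarith [this.1, this.2]
    · -- occ_meets
      intro a ha
      have hmono' : ∀ a', (P.Hcur (P.Rn ω n) (P.hst ω n) ∩ P.cellBox a').Nonempty →
          (P.Hcur (P.Rn ω (n + 1)) (P.hst ω (n + 1)) ∩ P.cellBox a').Nonempty := fun a' ⟨v, hv⟩ =>
        ⟨v, Finset.mem_inter.2 ⟨hHmono (Finset.mem_inter.1 hv).1, (Finset.mem_inter.1 hv).2⟩⟩
      rw [hR] at ha
      simp only at ha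
      by_cases hok : P.succVal (P.Rn ω n) (P.hst ω n) e (Q.record ω).2
      · rw [LState.update_of_ok _ _ _ hok] at ha
        rcases Finset.mem_insert.1 ha with rfl | ha'
        · -- the new cell: the witness of success
          obtain ⟨v, hvB, hvK⟩ := hok
          refine ⟨v, Finset.mem_inter.2 ⟨?_, hvB⟩⟩
          rw [hKeq, ← clus_read_eq_pclus (P.Op'_subset_Rv' hOK) ω]
          convert hvK using 2
          rw [P.known_eq_coe_Op']
          rfl
        · exact hmono' a (hI.occ_meets a ha')
      · rw [LState.update_of_not_ok _ _ _ hok] at ha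
        exact hmono' a (hI.occ_meets a ha)

/-- The invariant holds at all times. [folklore] -/
theorem runInv_all {ω : BondConfig (Site P.d × Layer GMParams.L P.r)} (hωE : ω ⊆ (layered (zdGraph P.d) GMParams.L P.r).edgeSet) :
    ∀ n, P.RunInv ω n
  | 0 => P.runInv_zero ω
  | n + 1 => runInv_succ hωE (runInv_all hωE n)

end Run

/-! ## Lawfulness -/

/-- **The field `probes`**: along the run on a configuration of layered lattice coins, the scheme
attempts a macro-edge whenever one is a candidate. [cite: MartineauTassion2017, §4 (the algorithm)] -/
theorem probes_scheme (ω : BondConfig (Site P.d × Layer GMParams.L P.r)) (hωE : ω ⊆ (layered (zdGraph P.d) GMParams.L P.r).edgeSet)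
    (n : ℕ) (hc : ((P.scheme).stN n ω).choice ≠ none) : (P.scheme).E.next ((P.scheme).E.hist n ω) ≠ none := by
  have hmst : (P.scheme).stN n ω = (P.Rn ω n).lst := P.mst_scheme _
  rw [hmst] at hc
  obtain ⟨e, he⟩ := Option.ne_none_iff_exists'.1 hc
  show P.next (P.hst ω n) ≠ none
  rw [next_hst_eq hωE (runInv_all hωE n) he]
  simp

/-- **The Grimmett–Marstrand scheme is lawful**: freshness, probes along lattice runs, and failure at
most `η (1-p)^{-t} + (1 - p^{r+1})^t` after every attempted history, granted the finite-size
hypothesis `FC η` (`η ≥ 0`, `p < 1`). [cite: MartineauTassion2017, §4 Lemmas 4.1–4.3 and (31)] -/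
theorem lawful_scheme {η : ℝ} (hη : 0 ≤ η) (hFC : P.FC η) (hp1 : (P.p : ℝ) < 1) (t : ℕ) :
    (P.scheme).Lawful (layered (zdGraph P.d) GMParams.L P.r) P.p (η / (1 - (P.p : ℝ)) ^ t + (1 - (P.p : ℝ) ^ (P.r + 1)) ^ t) :=
  ⟨P.fresh_scheme, P.probes_scheme, P.fail_scheme hη hFC hp1 t⟩

end GMParams

end GMStep

end Literature.Probability.Percolation
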